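import Summits.BirchSwinnertonDyer.BirchSwinnertonDyer.Theses.TwistFamilyManinDescent

/-!
# Sketch — crux idea `tame-torsor-descent` (TTD) for
`TwistFamilyManinDescent.EisensteinAdditiveManinResidual` (stmt-BirchSwinnertonDyer-25138)

First lemma of the line (the TRANSFER target C⁺, a strict strengthening of the crux on its
tame-window rows): for the lattice-optimal (= `X₀(N)`-optimal) curve, at a prime `p ≥ 5` with
`p² ∣ N`, twist-minimal additive (so potentially good with semistability defect
`e = 12 / gcd(12, v_p Δ_min) ∈ {3,4,6}`), and `e ≤ p − 2` (Raynaud/BLR window over the tame field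
`ℚ_p^nr(p^{1/e})`): `p ∤ c`.  No reducibility / Eisenstein hypothesis is used by the mechanism.
The crux then splits as WINDOW ∧ WALL by pure logic (`eisensteinResidual_of_window_of_wall`).
-/

namespace Summit.BirchSwinnertonDyer.BirchSwinnertonDyer.Cruxes.EisensteinAdditiveManinResidual.TameTorsorDescent

open Literature.NumberTheory.EllipticCurves.ModularForms WeierstrassCurve

/-- The semistability defect `e_p = 12 / gcd(12, v_p(Δ_min))` of a globally minimal model
(for `p ≥ 5` of additive potentially good reduction: the degree of the minimal tame extension of
`ℚ_p^nr` over which the curve acquires good reduction; Serre–Tate / Edixhoven 1991 Prop. 4). -/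
noncomputable def semistabilityDefect (W : WeierstrassCurve ℚ) [W.IsElliptic] [W.IsGloballyMinimal]
    (p : ℕ) : ℕ :=
  12 / Nat.gcd 12 (padicValInt p W.minimalDiscriminantInt)

/-- FIRST LEMMA / transfer target C⁺ (`[crux-idea tame-torsor-descent]`): on the TAME WINDOW
`e_p ≤ p − 2` the Manin constant of the lattice-optimal curve is a `p`-unit, for every prime
`p ≥ 5` with `p² ∣ N` and `W ⊗ χ_{p*}` not semistable at `p` (twist-minimal additive, potentially
good, `e_p ∈ {3,4,6}`).  Mechanism (NOTES.md §g24): BLR 7.5/4(i) closed immersions of the Néron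
models of `φ^∨E` AND of `A = ker φ` into that of `J₀(N)` over `O_L`, `L = ℚ_p^nr(p^{1/e})`
(`e(L) = e < p − 1`); fppf push-out of the `ℰ_L[deg φ]`-torsors into the smooth `𝒜_L` over the
strictly henselian `O_L` ⇒ `J₀(N)(L) ↠ E(L)`; trace to `ℚ_p^nr` ⇒ finite index; Néron-quotient
dichotomy + Zariski main theorem ⇒ `Lie φ` onto over `ℤ_p`; ČNS 2024 `ω_f ∈ Cot(𝒥₀(N)) ⊗ ℤ_(p)`
(`p ≥ 5`) ⇒ `p ∤ c`. -/
def TameWindowStrongManinUnit : Prop :=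
  ∀ (W : WeierstrassCurve ℚ) [W.IsElliptic] [W.IsGloballyMinimal] {N : ℕ} [NeZero N]
    (D : ModularParametrizationData W N) (p : ℕ) (hp : p.Prime),
    5 ≤ p → p ^ 2 ∣ N →
    ¬ ((W.quadraticTwist (((-1 : ℤ) ^ (p / 2) * p : ℤ) : ℚ)).HasGoodReductionAt
          ((Rat.HeightOneSpectrum.primesEquiv (R := ℤ)).symm ⟨p, hp⟩) ∨
       (W.quadraticTwist (((-1 : ℤ) ^ (p / 2) * p : ℤ) : ℚ)).HasMultiplicativeReductionAt
          ((Rat.HeightOneSpectrum.primesEquiv (R := ℤ)).symm ⟨p, hp⟩)) →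
    semistabilityDefect W p + 2 ≤ p →
    (∀ z ∈ D.L.lattice, ∃ w ∈ periodLattice D.f, z = D.c * w) →
    ¬ (p : ℤ) ∣ D.maninConstant

/-- The WALL remainder of the crux (lever (c)): the crux's own conclusion on its rows with
`e_p ≥ p − 1`, i.e. `(5; II, II*, III, III*)` and `(7; II, II*)` — stated as the crux with the
extra binder `p < e_p + 2`. -/
def EisensteinWallManinResidual : Prop :=
  mazur_not_dvd_maninConstant_of_odd → abbesUllmo_not_dvd_maninConstant_of_not_dvd_level →
  cesnavicius_not_two_dvd_maninConstant_of_two_dvd_level → exists_isNewformOf →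
  ∀ (W : WeierstrassCurve ℚ) [W.IsElliptic] [W.IsGloballyMinimal] {N : ℕ} [NeZero N]
    (D : ModularParametrizationData W N) (p : ℕ) (hp : p.Prime),
    (p = 5 ∨ p = 7 ∨ p = 13 ∨ (p = 163 ∧ 2 ^ 6 ∣ N)) → p ^ 2 ∣ N →
    ¬ W.HasIrreducibleModPGaloisRep p →
    ¬ ((W.quadraticTwist (((-1 : ℤ) ^ (p / 2) * p : ℤ) : ℚ)).HasGoodReductionAt
          ((Rat.HeightOneSpectrum.primesEquiv (R := ℤ)).symm ⟨p, hp⟩) ∨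
       (W.quadraticTwist (((-1 : ℤ) ^ (p / 2) * p : ℤ) : ℚ)).HasMultiplicativeReductionAt
          ((Rat.HeightOneSpectrum.primesEquiv (R := ℤ)).symm ⟨p, hp⟩)) →
    p < semistabilityDefect W p + 2 →
    (∀ z ∈ D.L.lattice, ∃ w ∈ periodLattice D.f, z = D.c * w) →
    ¬ (p : ℤ) ∣ D.maninConstant

/-- Composition (pure logic): WINDOW ∧ WALL ⇒ the crux, by `le_or_lt` on `e_p + 2` vs `p`
(every crux prime is `≥ 5`). -/
theorem eisensteinResidual_of_window_of_wall
    (hW : TameWindowStrongManinUnit) (hC : EisensteinWallManinResidual) :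
    Theses.TwistFamilyManinDescent.EisensteinAdditiveManinResidual := by
  intro h1 h2 h3 h4 W _ _ N _ D p hp hrow hN hred htw hopt
  rcases Nat.lt_or_ge p (semistabilityDefect W p + 2) with hlt | hle
  · exact hC h1 h2 h3 h4 W D p hp hrow hN hred htw hlt hopt
  · have h5 : 5 ≤ p := by
      rcases hrow with rfl | rfl | rfl | ⟨rfl, _⟩ <;> norm_num
    exact hW W D p hp h5 hN htw hle hopt

end Summit.BirchSwinnertonDyer.BirchSwinnertonDyer.Cruxes.EisensteinAdditiveManinResidual.TameTorsorDescent
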